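import Literature.Computability.AlgebraicComplexity.DIP20Thm23ChowCertificateFinal
import Literature.Computability.AlgebraicComplexity.DIP20Prop39Proofs
import Literature.Computability.AlgebraicComplexity.DIP20Prop71Proofs
import HarnessLib

/-!
# Dörfler–Ikenmeyer–Panova 2020, Thm. 2.3 (2)(a)/(b) from the two HALVES of Prop. 5.1 separately

Theorem-only bridge file (cell `val-lit`, DIP20 lane, literature-prover val-lit-t15 g4; no definition, no
named fact). J. Dörfler, C. Ikenmeyer, G. Panova, SIAM J. Appl. Algebra Geom. 4 (2020) = arXiv:1901.04576,
Thm. 2.3 (2) (arXiv p. 4) and its proof (§3 eq. (3.6), §5 Prop. 5.1 = "Proposition 18", §6–§7).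

State of the tree (2026-08-26): the multiplicity VALUES of Thm. 2.3 (2) are kernel theorems
(`coordRingMultiplicity_chowSet_three_six_dipPartition_eq` (= 7), `DIP20_prop_3_2_holds` (= 8, = 11),
`dip20_thm_2_3_2b_chow_lt` (< 11); val-lit-p6/t07), and the generator propositions 3.9 / 7.1 are discharged
(`DIP20_prop_3_9_holds`, `DIP20_prop_7_1_holds`, val-lit-t07), so each named fact `DIP20_thm_2_3_2a` /
`DIP20_thm_2_3_2b` rests on Prop. 5.1 alone (`DIP20_thm_2_3_2a_of_props`, `DIP20_thm_2_3_2b_of_props`). But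
the printed proof of (2)(a) uses only the FIRST sentence of Prop. 5.1 ("for all `μ ∈ X` of length 3 we have
`mult_μ(ℂ[Ch_3^6]) > 0`", `X` of Prop. 3.9) and that of (2)(b) only the SECOND ("If `X` is defined as in
Proposition 7.1, then for all `μ ∈ X` we have `mult_μ(ℂ[Ch_4^7]) > 0`"). This file records the two finer DAG
edges, so that the two halves — certified by different seats (val-lit split 2026-08-26T19:11Z: `Ch_3^6` half
t07, `Ch_4^7` half t15) — close their theorem independently:

* `dip20_eq_3_6_of_prop_5_1_left` — (3.6) from the `Ch_3^6` half (the tree's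
  `dip20_eq_3_6_of_prop_3_9_of_prop_5_1`, t07, verbatim but for the hypothesis);
* **`DIP20_thm_2_3_2a_of_prop_5_1_left`**: the `Ch_3^6` half of Prop. 5.1 ⇒ `DIP20_thm_2_3_2a`;
* **`DIP20_thm_2_3_2b_of_prop_5_1_right`**: the `Ch_4^7` half of Prop. 5.1 ⇒ `DIP20_thm_2_3_2b`;
* `DIP20_prop_5_1_of_halves`: the two halves ⇒ `DIP20_prop_5_1` (trivial `And.intro`, for the record).

HONEST FRAMING: bookkeeping in DIP's TOY MODEL (Chow variety versus power sums); nothing here bears on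
permanent versus determinant; VP ≠ VNP is not proved and nothing in this file is progress on it.

## References
* [DorflerIkenmeyerPanova2020] J. Dörfler, C. Ikenmeyer, G. Panova, *On geometric complexity theory:
  Multiplicity obstructions are stronger than occurrence obstructions*, SIAM J. Appl. Algebra Geom. 4
  (2020) = arXiv:1901.04576: Thm. 2.3 (2) (arXiv p. 4), eq. (3.6) and the proof sketch (pp. 5–7),
  Prop. 5.1 (p. 12), (3.11).

## Tree
`DIP20_thm_2_3_2a`, `DIP20_thm_2_3_2b`, `DIP20_prop_5_1`, `dipGenerators36`, `dipGenerators47`,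
`antitone_of_mem_dipGenerators36`, `coordRingMultiplicity_chowSet_rowDual_zero_pos`, `DIP20_eq_3_11_holds`,
`DIP20_prop_3_12_holds`, `dip20_noOccurrence47_of_prop_7_1_of_prop_5_1`-pattern (`DIP20MultiplicityObstructions`,
t07); `DIP20_prop_3_9_holds` (`DIP20Prop39Proofs`); `DIP20_prop_7_1_holds` (`DIP20Prop71Proofs`);
`seven_le_coordRingMultiplicity_chowSet_three_six`, `DIP20_thm_2_3_2b_of_props` (`DIP20Thm23ChowCertificateFinal`,
p6); `DIP20_thm_2_3_2a_of_values`-shape lemmas `coordRingMultiplicity_chowSet_three_six_dipPartition_le`,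
`DIP20_prop_3_2_holds`, `dip20_thm_2_3_2b_chow_lt_of_prop_3_2` / `DIP20_thm_2_3_2b_of_facts'`. Standard axioms only.
-/

namespace Literature.Computability.AlgebraicComplexity

open _root_.Literature.NumberTheory.DiophantineGeometry

/-- **(3.6) from the `Ch_3^6` half of Prop. 5.1** ("To prove (3.6) it is sufficient (and necessary) to show
that `mult_μ(ℂ[Ch_m^n]_d) > 0` for all `μ ∈ X` … If the length of `μ` is at most 2, we use [Prop. 3.12] …
for all 3-partitions `μ ∈ X` of length 3 … see Proposition 5.1", arXiv pp. 6–7): semigroup property (3.11),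
Prop. 3.12 for the rows of length `≤ 2` (their `a_μ(d[6]) > 0` by Prop. 3.9, discharged), the hypothesis for
the rows of length `3`. The tree's `dip20_eq_3_6_of_prop_3_9_of_prop_5_1` with exactly the half it uses.
[cite: DorflerIkenmeyerPanova2020, Thm. 2.3 (2)(a) / eq. (3.6) (proof, arXiv pp. 6–7; TeX multobs.tex L386 {eq:posplethimpliesposchow})] -/
theorem dip20_eq_3_6_of_prop_5_1_left
    (h51 : ∀ μ ∈ dipGenerators36, 0 < μ 2 → 0 < coordRingMultiplicity ℂ (chowSet ℂ 3 6) 6 (rowDual μ)) :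
    ∀ μ : Fin 3 → ℕ, Antitone μ → 0 < plethysmCoeff ℂ (Fin 3) 6 (rowDual μ) →
      0 < coordRingMultiplicity ℂ (chowSet ℂ 3 6) 6 (rowDual μ) := by
  intro μ hμ hpos
  have hmem := (DIP20_prop_3_9_holds μ hμ).1 hpos
  refine AddSubmonoid.closure_induction
    (motive := fun x _ => 0 < coordRingMultiplicity ℂ (chowSet ℂ 3 6) 6 (rowDual x))
    (fun x hx => ?_) (coordRingMultiplicity_chowSet_rowDual_zero_pos (by norm_num))
    (fun x y _ _ hx hy => DIP20_eq_3_11_holds 3 6 x y (by norm_num) hx hy) hmem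
  have hax := antitone_of_mem_dipGenerators36 hx
  by_cases hx2 : x 2 = 0
  · exact DIP20_prop_3_12_holds 6 x hax hx2
      ((DIP20_prop_3_9_holds x hax).2 (AddSubmonoid.subset_closure hx))
  · exact h51 x hx (Nat.pos_of_ne_zero hx2)

/-- **Thm. 2.3 (2)(a) from the `Ch_3^6` half of Prop. 5.1 alone** (the value `7` by p6's certificate
`seven_le_coordRingMultiplicity_chowSet_three_six` and t07's upper bound, the value `8` by
`DIP20_prop_3_2_holds`, the no-occurrence clause (3.6) by `dip20_eq_3_6_of_prop_5_1_left`).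
[cite: DorflerIkenmeyerPanova2020, Thm. 2.3 (2)(a) (arXiv p. 4; TeX multobs.tex L280 {thm:main})] -/
theorem DIP20_thm_2_3_2a_of_prop_5_1_left
    (h51 : ∀ μ ∈ dipGenerators36, 0 < μ 2 → 0 < coordRingMultiplicity ℂ (chowSet ℂ 3 6) 6 (rowDual μ)) :
    DIP20_thm_2_3_2a :=
  ⟨le_antisymm (coordRingMultiplicity_chowSet_three_six_dipPartition_le _)
      (seven_le_coordRingMultiplicity_chowSet_three_six (by norm_num)),
    DIP20_prop_3_2_holds.1, dip20_eq_3_6_of_prop_5_1_left h51⟩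

/-- **Thm. 2.3 (2)(b) from the `Ch_4^7` half of Prop. 5.1 alone** ("The proof of Theorem 2.3 (2b) is
completely analogous … Let `m = 4`, `n = 7`", arXiv p. 7: Prop. 7.1 = `DIP20_prop_7_1_holds`, the values by
`DIP20_prop_3_2_holds`, the semigroup property (3.11)).
[cite: DorflerIkenmeyerPanova2020, Thm. 2.3 (2)(b) (arXiv p. 4; proof p. 7)] -/
theorem DIP20_thm_2_3_2b_of_prop_5_1_right
    (h51 : ∀ μ ∈ dipGenerators47, 0 < coordRingMultiplicity ℂ (chowSet ℂ 4 7) 7 (rowDual μ)) :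
    DIP20_thm_2_3_2b := by
  refine ⟨dip20_thm_2_3_2b_chow_lt_of_prop_3_2 DIP20_prop_3_2_holds,
    dip20_thm_2_3_2b_pow_eq_of_prop_3_2 DIP20_prop_3_2_holds, ?_⟩
  intro μ hμ hpos
  have hmem := (DIP20_prop_7_1_holds μ hμ).1 hpos
  exact AddSubmonoid.closure_induction
    (motive := fun x _ => 0 < coordRingMultiplicity ℂ (chowSet ℂ 4 7) 7 (rowDual x))
    (fun x hx => h51 x hx) (coordRingMultiplicity_chowSet_rowDual_zero_pos (by norm_num))
    (fun x y _ _ hx hy => DIP20_eq_3_11_holds 4 7 x y (by norm_num) hx hy) hmem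

/-- Prop. 5.1 is the conjunction of its two printed sentences. [cite: DorflerIkenmeyerPanova2020, Prop. 5.1 (arXiv p. 12)] -/
theorem DIP20_prop_5_1_of_halves
    (h36 : ∀ μ ∈ dipGenerators36, 0 < μ 2 → 0 < coordRingMultiplicity ℂ (chowSet ℂ 3 6) 6 (rowDual μ))
    (h47 : ∀ μ ∈ dipGenerators47, 0 < coordRingMultiplicity ℂ (chowSet ℂ 4 7) 7 (rowDual μ)) :
    DIP20_prop_5_1 :=
  ⟨h36, h47⟩

end Literature.Computability.AlgebraicComplexity
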